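import Mathlib
import Summits.Ventures.PercRepro2.Defs
import Summits.Ventures.PercRepro2.Graph
import Summits.Ventures.PercRepro2.Harris
import Summits.Ventures.PercRepro2.Events
import Summits.Ventures.PercRepro2.Independence
import Summits.Ventures.PercRepro2.Induced
import Summits.Ventures.PercRepro2.ContractDefs
import Summits.Ventures.PercRepro2.GateDefs
import Summits.Ventures.PercRepro2.HullTree
import Summits.Ventures.PercRepro2.GateFeedbackForest
import Summits.Ventures.PercRepro2.GateFeedbackExitGeneral
import Summits.Ventures.PercRepro2.GateContract

/-!
# The exit-vertex gate for an avoided SET (blind cell PercRepro2, mine-c g10;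
proofs/MINEC-FEEDBACK.md §6)

The exit version of `GateContract.gateRow_of_isForest_del_set`: contract the avoided set `T` to
`t₀ ∈ T` (`GateContract.gateRow_contract_rep_iff`) and apply Theorem 1′ with a general entry set
(`GateFeedback.gateRow_general_of_isForest_del_exit`) to `G/T`. The hypothesis is that every cycle
of `G/T` passes through the exit vertex `w` (`(G/T) − w` is a forest); contraction may create
parallel edges or loops at `t₀`, so this is stated on the contracted family itself.
-/

namespace Summit.Ventures.PercRepro2

namespace GateContractExit

open scoped Classical

variable {V : Type*} {E : Type*} [Fintype E] [Fintype V]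
variable {R : Type*} [Field R] [LinearOrder R] [IsStrictOrderedRing R]

/-- **THEOREM (exit version for an avoided set).** If `(G/T) − w` is a forest (every cycle of
`G/T` passes through the exit vertex `w`), then `(GATE A,{w})` holds at the avoided set `T` for
every root `s ∉ T`, markers `a, b` and entry set `A`. -/
theorem gateRow_of_isForest_del_exit_set {p : E → R} (hp : IsProbVec p) {ends : E → Sym2 V}
    (s : V) (T : Finset V) (t₀ : V) (a b w : V) (A : Finset V) (ht₀ : t₀ ∈ T) (hs : s ∉ T)
    (hw : w ∉ T) (hF : Hull.IsForest (GateFeedback.endsF (Contract.contractEnds ends T t₀) w)) :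
    Gate.GateRow p ends s T a b A {w} := by
  rw [← GateContract.gateRow_contract_rep_iff p ht₀ hs a b A hw]
  exact GateFeedback.gateRow_general_of_isForest_del_exit hp s t₀ a b w A hF
    (fun h => hw (by rw [h]; exact ht₀))

/-- The free one-sided gate at an avoided set `T` when `(G/T) − w` is a forest. -/
theorem gateRow_free_of_isForest_del_exit_set {p : E → R} (hp : IsProbVec p) {ends : E → Sym2 V}
    (s : V) (T : Finset V) (t₀ : V) (a b u w : V) (ht₀ : t₀ ∈ T) (hs : s ∉ T) (hw : w ∉ T)
    (hF : Hull.IsForest (GateFeedback.endsF (Contract.contractEnds ends T t₀) w)) :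
    Gate.GateRow p ends s T a b {u} {w} :=
  gateRow_of_isForest_del_exit_set hp s T t₀ a b w {u} ht₀ hs hw hF

end GateContractExit

end Summit.Ventures.PercRepro2
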